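import Summits.ResolutionOfSingularities.ResolutionOfSingularities.Theorems.PurelyInseparableDim4PhiLineChartHom
import Literature.AlgebraicGeometry.Resolution.OrdZeroBasics
import HarnessLib

/-!
# (K-Φ2) chain dictionary II: the next STATE's residual is `ε · H₀ + R̃` (unit `ε`, cleaning correction `R̃ ∈ (x_h^{p − r′_h})`)

Cell `res-dim4-pi` (D-0157 DOOR 2), Φ = β_h line of res-dim4-idea-1 (CARD I-1-8; memo §5 (D1) «STEP = STRICT TRANSFORM + CLEANING»,
§1 (I1′) «cleaning is inert on the strip `a₁ < 1`»). (K-Φ2) I (`…PhiLineChartHom`) identified the weak transform of `(G)` under the tree's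
chart step with `(H₀)`, `H₀ = translate b (chartTransform d univ j G)`. This file computes the tree's next STATE: for a state `s` with
`s.F = x^r · G`, `ord₀ G = d`, `p ≤ |r| + d`, and the step at the point `b` of the `x_j`-chart (`b_j = 0`):

* §1 `coordBlowupSubst_monomial_univ`, **`chartTransform_monomial_mul`**:
  `chartTransform p univ j (x^r · G) = x^{r₁} · chartTransform d univ j G`, `r₁ = r.update j (|r| + d − p)`;
* §2 `translate_monomial_one_eq_mul_prod`: `translate b (x^e) = x^{e|_{b = 0}} · ∏_{b_i ≠ 0} (x_i + b_i)^{e_i}`; `constantCoeff_prod_ne_zero`;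
* §3 **`pointTransform_eq_monomial_mul`**: `pointTransform p univ j b s = x^{r′} · (ε · H₀)`, `r′ = (r|_{b = 0}).update j (|r| + d − p)`,
  `ε = ∏_{b_i ≠ 0} (x_i + b_i)^{r_i}`, `ε(0) ≠ 0`;
* §4 **`deletePthPowers_monomial_mul`** (cleaning under a monomial factor): `deletePthPowers p (x^{r′} · P) = x^{r′} · (P − R₀)` with
  `R₀ ∈ (x_h^{p − r′_h})` for EVERY letter `h` with `p ∤ r′_h` (a deleted monomial `x^m` has `p ∣ m_h ≥ r′_h`, so `m_h ≥ p`);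
* §5 **`step_F_eq_monomial_mul_residual`**: `(step p univ j b s).F = x^{r′} · G′` with `G′ = ε · H₀ + R̃`, `R̃ ∈ (x_h^{p − r′_h})` for every
  `h` with `p ∤ r′_h`; and `step_r_eq` (`(step …).r = r′` when `r = s.r`).

With (K-Φ2) I and (K-Φ3) V (`PhiLine.betaS_eq_of_cleaning`: in the arrival frame, whose `u₁` is the critical letter `x_h` with
`r′_h + d = p`, `β((G′)) = β((H₀))` whenever `α < 1`) this is the `J (k+1)`-slot of `keepCount_le_betaS_of_betaS_le`. [OURS · counted 0 ·
AI work weaker than expert review.] Nothing here proves K2(p), the β_h line, or resolution of singularities in dimension ≥ 4 / characteristic p.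

Sources: H. Hauser, BAMS 47 (2010) §§F–G (`f′ = x′^{r′} g′`, cleaning) [`Hauser2010`]; H. Hauser, S. Perlega, PRIMS 55 (2019) §2 [`HauserPerlega2019PRIMS`];
V. Cossart, U. Jannsen, S. Saito, LNM **2270** (2020) (9.6)–(9.7) [`CossartJannsenSaito2020`].
-/

set_option linter.dupNamespace false

noncomputable section

namespace Summit.ResolutionOfSingularities.ResolutionOfSingularities.Theorems.PIDim4

namespace PhiLine

open MvPolynomial Finset IsLocalRing
open Literature.AlgebraicGeometry.Resolution
open Literature.AlgebraicGeometry.Resolution.Hauser2010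

variable {K : Type} [Field K]

/-! ## §1 The chart transform of `x^r · G` -/

/-- `coordBlowupSubst K univ j (x^r) = x_j^{|r| − r_j} · x^r`. [cite: Hu2025, Prop. 5.3] -/
theorem coordBlowupSubst_monomial_univ (j : Fin 4) (r : Fin 4 →₀ ℕ) (c : K) :
    coordBlowupSubst K (↑(Finset.univ : Finset (Fin 4))) j (monomial r c) = monomial (Finsupp.single j (r.degree - r j) + r) c := by
  rw [ChartDictionary.coordBlowupSubst_monomial]
  have h : r j + ∑ i ∈ (Finset.univ : Finset (Fin 4)).erase j, r i = ∑ i, r i :=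
    Finset.add_sum_erase (Finset.univ : Finset (Fin 4)) (⇑r) (Finset.mem_univ j)
  have hdeg : r.degree = ∑ i, r i := Finsupp.degree_eq_sum r
  have hsum : ∑ i ∈ (Finset.univ : Finset (Fin 4)).erase j, r i = r.degree - r j := by omega
  rw [hsum]

/-- `ord₀ (x^r · G) = |r| + ord₀ G`. [cite: Hauser2010, §F] -/
theorem ordZero_monomial_one_mul (r : Fin 4 →₀ ℕ) (G : MvPolynomial (Fin 4) K) :
    ordZero (monomial r (1 : K) * G) = (r.degree : ℕ∞) + ordZero G := by
  rw [ordZero_mul, ordZero_monomial r one_ne_zero]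

/-- **The chart transform of `x^r · G`**: dividing the total transform by `x_j^p` leaves `x^{r₁} · chartTransform d univ j G` with
`r₁ = r.update j (|r| + d − p)` (`d ≤ ord₀ G`, `p ≤ |r| + d`). [cite: Hauser2010, §F] -/
theorem chartTransform_monomial_mul {p d : ℕ} (j : Fin 4) {r : Fin 4 →₀ ℕ} {G : MvPolynomial (Fin 4) K} (hd : (d : ℕ∞) ≤ ordZero G)
    (hp : p ≤ r.degree + d) :
    CentreBlowup.chartTransform p Finset.univ j (monomial r 1 * G) =
      monomial (r.update j (r.degree + d - p)) 1 * CentreBlowup.chartTransform d Finset.univ j G := by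
  have hordF : (p : ℕ∞) ≤ CentreBlowup.ordAlong Finset.univ (monomial r (1 : K) * G) := by
    rw [CentreBlowup.ordAlong_univ, ordZero_monomial_one_mul]
    calc (p : ℕ∞) ≤ ((r.degree + d : ℕ) : ℕ∞) := by exact_mod_cast hp
      _ = (r.degree : ℕ∞) + (d : ℕ∞) := by push_cast; rfl
      _ ≤ (r.degree : ℕ∞) + ordZero G := add_le_add le_rfl hd
  have h1 := ChartDictionary.coordBlowupSubst_eq_X_pow_mul_chartTransform (K := K) (Finset.mem_univ j) p (monomial r 1 * G) hordF
  have h2 := ChartDictionary.coordBlowupSubst_eq_X_pow_mul_chartTransform (K := K) (Finset.mem_univ j) d G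
    (by rwa [CentreBlowup.ordAlong_univ])
  rw [map_mul, coordBlowupSubst_monomial_univ, h2] at h1
  -- cancel `x_j^p = monomial (single j p) 1`
  have hX : (X j : MvPolynomial (Fin 4) K) ^ p = monomial (Finsupp.single j p) 1 := by rw [X_pow_eq_monomial]
  rw [hX] at h1
  have hXd : (X j : MvPolynomial (Fin 4) K) ^ d = monomial (Finsupp.single j d) 1 := by rw [X_pow_eq_monomial]
  rw [hXd, ← mul_assoc, monomial_mul, mul_one] at h1
  have hexp : Finsupp.single j (r.degree - r j) + r + Finsupp.single j d = Finsupp.single j p + r.update j (r.degree + d - p) := by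
    ext i
    simp only [Finsupp.add_apply, Finsupp.single_apply, Finsupp.update_apply]
    have hrj : r j ≤ r.degree := by rw [Finsupp.degree_eq_sum]; exact Finset.single_le_sum (fun _ _ => Nat.zero_le _) (Finset.mem_univ j)
    by_cases hij : j = i
    · subst hij; simp only [if_true]; omega
    · simp only [if_neg hij, if_neg (Ne.symm hij)]; omega
  rw [hexp, show monomial (Finsupp.single j p + r.update j (r.degree + d - p)) (1 : K) =
      monomial (Finsupp.single j p) 1 * monomial (r.update j (r.degree + d - p)) 1 by rw [monomial_mul, mul_one],
    mul_assoc, monomial_one_mul_cancel_left_iff] at h1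
  exact h1.symm

/-! ## §2 Translating a monomial: kept letters and unit factors -/

/-- `translate b (x^e) = x^{e|_{b=0}} · ∏_{b_i ≠ 0} (x_i + b_i)^{e_i}`. [cite: Hauser2010, §F] -/
theorem translate_monomial_one_eq_mul_prod [DecidableEq K] (b : Fin 4 → K) (e : Fin 4 →₀ ℕ) :
    PointBlowup.translate b (monomial e (1 : K)) =
      monomial (e.filter fun i => b i = 0) 1 * ∏ i ∈ Finset.univ.filter (fun i => b i ≠ 0), (X i + C (b i)) ^ e i := by
  have hprod : PointBlowup.translate b (monomial e (1 : K)) = ∏ i, (X i + C (b i)) ^ e i := by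
    unfold PointBlowup.translate
    rw [aeval_monomial, algebraMap_eq, C_1, one_mul, Finsupp.prod_fintype _ _ (fun i => pow_zero _)]
  rw [hprod, ← Finset.prod_filter_mul_prod_filter_not Finset.univ (fun i => b i = 0)]
  congr 1
  · rw [monomial_eq, C_1, one_mul, Finsupp.prod_fintype _ _ (fun i => pow_zero _), ← Finset.prod_filter_mul_prod_filter_not
      Finset.univ (fun i => b i = 0)]
    have h2 : ∏ i ∈ Finset.univ.filter (fun i => ¬ b i = 0), (X i : MvPolynomial (Fin 4) K) ^ (e.filter fun i => b i = 0) i = 1 := by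
      refine Finset.prod_eq_one fun i hi => ?_
      rw [Finsupp.filter_apply_neg (fun i => b i = 0) e (Finset.mem_filter.mp hi).2, pow_zero]
    rw [h2, mul_one]
    refine Finset.prod_congr rfl fun i hi => ?_
    rw [(Finset.mem_filter.mp hi).2, C_0, add_zero, Finsupp.filter_apply_pos (fun i => b i = 0) e (Finset.mem_filter.mp hi).2]

/-- A product of powers of `x_i + b_i` with `b_i ≠ 0` has non-zero value at the origin (it is a unit of `𝒪`). [folklore] -/
theorem constantCoeff_prod_ne_zero [DecidableEq K] (b : Fin 4 → K) (e : Fin 4 → ℕ) :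
    constantCoeff (∏ i ∈ Finset.univ.filter (fun i => b i ≠ 0), ((X i + C (b i) : MvPolynomial (Fin 4) K)) ^ e i) ≠ 0 := by
  rw [map_prod]
  refine Finset.prod_ne_zero_iff.mpr fun i hi => ?_
  rw [map_pow, map_add, constantCoeff_X, constantCoeff_C, zero_add]
  exact pow_ne_zero _ (Finset.mem_filter.mp hi).2

/-! ## §3 The point transform of `x^r · G` -/

/-- Filtering an update at a kept letter. [folklore] -/
theorem filter_update_eq [DecidableEq K] {b : Fin 4 → K} {j : Fin 4} (hbj : b j = 0) (r : Fin 4 →₀ ℕ) (v : ℕ) :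
    (r.update j v).filter (fun i => b i = 0) = (r.filter fun i => b i = 0).update j v := by
  ext i
  by_cases hij : i = j
  · subst hij
    rw [Finsupp.filter_apply_pos (fun i => b i = 0) _ hbj, Finsupp.coe_update, Finsupp.coe_update, Function.update_self,
      Function.update_self]
  · rw [Finsupp.coe_update, Function.update_of_ne hij, Finsupp.filter_apply, Finsupp.filter_apply, Finsupp.coe_update,
      Function.update_of_ne hij]

/-- **The point transform of `x^r · G`**: `pointTransform p univ j b s = x^{r′} · (ε · H₀)` with `r′ = (r|_{b=0}).update j (|r| + d − p)`,
`ε = ∏_{b_i ≠ 0} (x_i + b_i)^{r_i}` (the lost boundary components become units), `H₀ = translate b (chartTransform d univ j G)`.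
[cite: Hauser2010, §F] [cite: HauserPerlega2019PRIMS, §2] -/
theorem pointTransform_eq_monomial_mul {p d : ℕ} [DecidableEq K] {s : State K} {r : Fin 4 →₀ ℕ} {G : MvPolynomial (Fin 4) K}
    (hF : s.F = monomial r 1 * G) (hd : (d : ℕ∞) ≤ ordZero G) (hp : p ≤ r.degree + d) (j : Fin 4) {b : Fin 4 → K} (hbj : b j = 0) :
    CentreBlowup.pointTransform p Finset.univ j b s =
      monomial ((r.filter fun i => b i = 0).update j (r.degree + d - p)) 1 *
        ((∏ i ∈ Finset.univ.filter (fun i => b i ≠ 0), (X i + C (b i)) ^ r i) *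
          PointBlowup.translate b (CentreBlowup.chartTransform d Finset.univ j G)) := by
  unfold CentreBlowup.pointTransform
  rw [hF, chartTransform_monomial_mul j hd hp, translate_mul_eq, translate_monomial_one_eq_mul_prod, filter_update_eq hbj, mul_assoc]
  congr 2
  refine Finset.prod_congr rfl fun i hi => ?_
  have hij : i ≠ j := fun h => (Finset.mem_filter.mp hi).2 (h ▸ hbj)
  rw [Finsupp.coe_update, Function.update_of_ne hij]

/-! ## §4 Cleaning under a monomial factor -/

/-- A deleted monomial sits `p − r′_h` above `x^{r′}` in every letter `h` with `p ∤ r′_h`. [cite: Hauser2010, §G] -/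
theorem sub_le_sub_of_dvd_of_not_dvd {p a m : ℕ} (hm : p ∣ m) (hle : a ≤ m) (ha : ¬ p ∣ a) : p - a ≤ m - a := by
  obtain ⟨k, rfl⟩ := hm
  rcases Nat.eq_zero_or_pos k with rfl | hk
  · simp at hle; subst hle; exact absurd (dvd_zero p) ha
  · have : p ≤ p * k := Nat.le_mul_of_pos_right p hk
    omega

/-- A monomial whose `h`-exponent is `≥ e` lies in `(x_h^e)`. [folklore] -/
theorem monomial_mem_span_X_pow {h : Fin 4} {e : ℕ} {n : Fin 4 →₀ ℕ} (hn : e ≤ n h) (c : K) :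
    monomial n c ∈ Ideal.span {(X h : MvPolynomial (Fin 4) K) ^ e} := by
  rw [Ideal.mem_span_singleton]
  refine ⟨monomial (n - Finsupp.single h e) c, ?_⟩
  rw [X_pow_eq_monomial, monomial_mul, one_mul]
  have hexp : Finsupp.single h e + (n - Finsupp.single h e) = n := by
    ext i
    rw [Finsupp.add_apply, Finsupp.tsub_apply, Finsupp.single_apply]
    by_cases hi : h = i
    · subst hi; rw [if_pos rfl]; omega
    · rw [if_neg hi]; omega
  rw [hexp]

/-- **Cleaning under a monomial factor**: `deletePthPowers p (x^{r′} · P) = x^{r′} · (P − R₀)` where `R₀` collects the deleted monomials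
divided by `x^{r′}`; for every letter `h` with `p ∤ r′_h`, `R₀ ∈ (x_h^{p − r′_h})`. [cite: Hauser2010, §G] -/
theorem deletePthPowers_monomial_mul (p : ℕ) (r' : Fin 4 →₀ ℕ) (P : MvPolynomial (Fin 4) K) :
    ∃ R₀ : MvPolynomial (Fin 4) K, deletePthPowers p (monomial r' 1 * P) = monomial r' 1 * (P - R₀) ∧
      ∀ h : Fin 4, ¬ p ∣ r' h → R₀ ∈ Ideal.span {(X h : MvPolynomial (Fin 4) K) ^ (p - r' h)} := by
  classical
  set Q := monomial r' (1 : K) * P with hQ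
  refine ⟨∑ m ∈ Q.support with IsPthPowerExponent p m, monomial (m - r') (coeff m Q), ?_, ?_⟩
  · -- `deletePthPowers p Q = Q − Σ_{PP} monomial m (coeff m Q)` and the sum is `x^{r′} · R₀`
    have hsplit : (∑ m ∈ Q.support with IsPthPowerExponent p m, monomial m (coeff m Q)) + deletePthPowers p Q = Q := by
      have := Finset.sum_filter_add_sum_filter_not Q.support (IsPthPowerExponent p) (fun m => monomial m (coeff m Q))
      rw [← Q.as_sum] at this
      exact this
    have hle : ∀ m ∈ Q.support, r' ≤ m := by
      intro m hm
      by_contra h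
      rw [mem_support_iff, hQ, coeff_monomial_mul', if_neg h] at hm
      exact hm rfl
    have hsum : (∑ m ∈ Q.support with IsPthPowerExponent p m, monomial m (coeff m Q)) =
        monomial r' 1 * ∑ m ∈ Q.support with IsPthPowerExponent p m, monomial (m - r') (coeff m Q) := by
      rw [Finset.mul_sum]
      refine Finset.sum_congr rfl fun m hm => ?_
      rw [monomial_mul, one_mul, add_tsub_cancel_of_le (hle m (Finset.mem_filter.mp hm).1)]
    rw [mul_sub, ← hsum]
    exact (eq_sub_of_add_eq' hsplit)
  · intro h hh
    refine Ideal.sum_mem _ fun m hm => ?_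
    obtain ⟨hmQ, hPP⟩ := Finset.mem_filter.mp hm
    have hle : r' ≤ m := by
      by_contra h'
      rw [mem_support_iff, hQ, coeff_monomial_mul', if_neg h'] at hmQ
      exact hmQ rfl
    refine monomial_mem_span_X_pow ?_ _
    rw [Finsupp.tsub_apply]
    exact sub_le_sub_of_dvd_of_not_dvd ((isPthPowerExponent_iff p m).mp hPP h) (hle h) hh

/-! ## §5 The next state -/

/-- **The tree's next residual**: for `s.F = x^r · G`, `ord₀ G ≥ d`, `p ≤ |r| + d`, `b_j = 0`:
`(step p univ j b s).F = x^{r′} · (ε · H₀ + R̃)` with `r′ = (r|_{b=0}).update j (|r| + d − p)`, `ε = ∏_{b_i ≠ 0}(x_i + b_i)^{r_i}`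
(`ε(0) ≠ 0`), `H₀ = translate b (chartTransform d univ j G)`, and `R̃ ∈ (x_h^{p − r′_h})` for every letter `h` with `p ∤ r′_h` — in
particular `R̃ ∈ (x_h^d)` for a CRITICAL letter (`r′_h + d = p`). [cite: Hauser2010, §§F–G] [cite: HauserPerlega2019PRIMS, §2] -/
theorem step_F_eq_monomial_mul_residual {p d : ℕ} [DecidableEq K] {s : State K} {r : Fin 4 →₀ ℕ} {G : MvPolynomial (Fin 4) K}
    (hF : s.F = monomial r 1 * G) (hd : (d : ℕ∞) ≤ ordZero G) (hp : p ≤ r.degree + d) (j : Fin 4) {b : Fin 4 → K} (hbj : b j = 0) :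
    ∃ R : MvPolynomial (Fin 4) K,
      (CentreBlowup.step p Finset.univ j b s).F =
        monomial ((r.filter fun i => b i = 0).update j (r.degree + d - p)) 1 *
          ((∏ i ∈ Finset.univ.filter (fun i => b i ≠ 0), (X i + C (b i)) ^ r i) *
              PointBlowup.translate b (CentreBlowup.chartTransform d Finset.univ j G) + R) ∧
      ∀ h : Fin 4, ¬ p ∣ ((r.filter fun i => b i = 0).update j (r.degree + d - p)) h →
        R ∈ Ideal.span {(X h : MvPolynomial (Fin 4) K) ^ (p - ((r.filter fun i => b i = 0).update j (r.degree + d - p)) h)} := by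
  obtain ⟨R₀, hR₀, hmem⟩ := deletePthPowers_monomial_mul (K := K) p ((r.filter fun i => b i = 0).update j (r.degree + d - p))
    ((∏ i ∈ Finset.univ.filter (fun i => b i ≠ 0), (X i + C (b i)) ^ r i) *
      PointBlowup.translate b (CentreBlowup.chartTransform d Finset.univ j G))
  refine ⟨-R₀, ?_, fun h hh => (Ideal.neg_mem_iff _).mpr (hmem h hh)⟩
  change deletePthPowers p (CentreBlowup.pointTransform p Finset.univ j b s) = _
  rw [pointTransform_eq_monomial_mul hF hd hp j hbj, hR₀, sub_eq_add_neg]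

/-- The new multiplicities of the step: `(step p univ j b s).r = (s.r|_{b=0}).update j (ord₀ s.F − p)`. [cite: Hauser2010, §F] -/
theorem step_r_eq {p : ℕ} [DecidableEq K] (s : State K) (j : Fin 4) (b : Fin 4 → K) :
    (CentreBlowup.step p Finset.univ j b s).r = (s.r.filter fun i => b i = 0).update j ((ordZero s.F).toNat - p) := by
  change CentreBlowup.newMult p Finset.univ j b s = _
  unfold CentreBlowup.newMult
  rw [CentreBlowup.ordAlong_univ]

/-- For `s.F = x^r · G` with `ord₀ G = d` (finite): `ord₀ s.F = |r| + d`, so the new exponent at `x_j` is `|r| + d − p`. [cite: Hauser2010, §F] -/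
theorem ordZero_toNat_eq {d : ℕ} {s : State K} {r : Fin 4 →₀ ℕ} {G : MvPolynomial (Fin 4) K} (hF : s.F = monomial r 1 * G)
    (hd : ordZero G = d) : (ordZero s.F).toNat = r.degree + d := by
  rw [hF, ordZero_monomial_one_mul, hd]
  rfl

end PhiLine

end Summit.ResolutionOfSingularities.ResolutionOfSingularities.Theorems.PIDim4

end
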